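import Literature.Barriers.CriticalPhenomena.SubexponentialGrowthZdUniqueness
import Mathlib.Analysis.SpecialFunctions.Pow.Real
import HarnessLib

/-!
# Easo–Hutchcroft 2023, Proposition 4.1 ("Snowballing"), in the `Λ = V` form (15): a NAMED FACT,
# with the sprinkling coordinates `Spr(p; λ)`, `δ(p, q)` of §3 and the set-to-set two-point function `τ_p(A, B)` of §4.1

Topic `Probability/Percolation`; namespace `Literature.Probability.Percolation` (vocabulary and the proved
`δ`-calculus in the sub-namespace `Snowballing`, which names the method of §4 of the source). A NAMED FACT
(`def … : Prop`, no proof claimed; users take `(h : EasoHutchcroft2023_snowballing)`), typed for the lane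
`prim-bschramm` negation theorem «NearCriticalShortLRO» on the two Grigorchuk witnesses
(`Summits/CriticalPhenomena/PercolationContinuityZ3/Theorems/Transplant/GrigorchukWitnessNearCriticalLRODefs.lean`),
which consumes exactly the implication (15) below.

## Source (read on the held text `paper:arxiv-2310.10983`, PDF page numbers)

P. Easo, T. Hutchcroft, *The critical percolation probability is local*, arXiv:2310.10983 (2023)
[EasoHutchcroft2023].

* p. 3 (standing conventions): "We allow our graphs to contain loops and multiple edges, and make the implicit
  assumption throughout the paper that all transitive graphs are connected and locally finite"; "transitive" =
  "any vertex can be mapped to any other vertex by an automorphism of the graph".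
* §3.1, p. 19: "We define the *sprinkling function* `Spr : (0, 1) × ℝ → (0, 1)` by `Spr(p; λ) = 1 − (1 − p)^{e^λ}`
  … The sprinkling functions form a semigroup in the sense that `Spr(p; λ + μ) = Spr(Spr(p; λ); μ)` … For each
  `0 < p, q < 1` we define `δ(p, q) = log( log(1 − max{p, q}) / log(1 − min{p, q}) )`, so that
  `max{p, q} = Spr(min{p, q}; δ(p, q))`."
* §4.1, p. 25: "Given (not necessarily finite) non-empty sets of vertices `A`, `B`, and `Λ` in a graph `G = (V, E)`
  and a parameter `p ∈ [0, 1]`, we define `τ^Λ_p(A, B) := min_{a ∈ A, b ∈ B} P_p(a ↔^Λ b)`, where we recall that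
  `{a ↔^Λ b}` denotes the event that `a` is connected to `b` by an open path all of whose vertices belong to `Λ`.
  We will also write `τ^Λ_p(A) := τ^Λ_p(A, A)` and `τ_p(A, B) := τ^V_p(A, B)`."
* **Proposition 4.1 (Snowballing), p. 25 l. 39 – p. 26 l. 8.** "For each `d ≥ 1` and `D < ∞` there exist positive
  constants `c₁ = c₁(D)` and `h₀ = h₀(d, D)`, and universal positive constants `c₂` and `c₃` such that the following
  holds. Let `G = (V, E)` be a unimodular transitive graph with vertex degree `d`, let `A₁, …, A_n` be non-empty sets
  of vertices in `G`, and suppose that `0 < p₁ < p₂ < 1` are such that there is at most one infinite cluster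
  `P_p`-almost surely for every `p ∈ [p₁, p₂]`. Let `h ≥ (min_i |A_i|)⁻¹` and let `r` be a positive integer with
  `hr ≥ 1` such that `P_p(Piv[1, hr]) < h` for every `p ∈ [p₁, p₂]`. If `p₁ ≥ 1/d`, `δ = δ(p₁, p₂) ≤ D`, and
  `h ≤ h₀` then the implication
  `( h^{c₁δ³} ≤ c₃ n⁻¹ and τ^Λ_{p₁}(A_i ∪ A_{i+1}) ≥ 4 h^{c₁δ⁴} for every i = 1, …, n − 1 )
     ⇒ ( τ^{B_{2r}(Λ)}_{p₂}(A₁, A_n) ≥ c₂ τ^Λ_{p₁}(A₁) τ^Λ_{p₁}(A_n) )`                                        (14)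
  holds for every non-empty set of vertices `Λ` in `G`. In particular, taking `Λ = V` yields the implication
  `( h^{c₁δ³} ≤ c₃ n⁻¹ and τ_{p₁}(A_i ∪ A_{i+1}) ≥ 4 h^{c₁δ⁴} for every i = 1, …, n − 1 )
     ⇒ ( τ_{p₂}(A₁, A_n) ≥ c₂ τ_{p₁}(A₁) τ_{p₁}(A_n) )`                                                        (15)
  whenever `p₁ ≥ 1/d`, `δ = δ(p₁, p₂) ≤ D`, and `h ≤ h₀`."
* **Remark 4.1 (p. 26).** "The fact that we can always find an integer `r` such that `P_p(Piv[1, hr]) < h` for every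
  `p ∈ [p₁, p₂]` can be deduced from the fact that there is at most one infinite cluster `P_p`-almost surely for every
  `p ∈ [p₁, p₂]` by an easy compactness argument." (`Piv[m, n]`, §2.1 p. 16: "the event that there exist two
  distinct clusters in `ω ∩ B_n` that each intersect both spheres `S_n` and `S_m`".)

## What is typed, and the deliberate specialisations (each also flagged at the declaration)

* `Snowballing.tau G p x y = P_p(x ↔ y)` (the tree's `bondPercolation` / `openConn`), `Snowballing.tauSet G p A B`
  = `τ_p(A, B)` as the INFIMUM (`sInf`) of `P_p(a ↔ b)` over `A ×ˢ B` — the source's "min" over a possibly infinite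
  set of pairs (for the `Λ = V` form only `τ_p = τ^V_p` is needed, and `{a ↔^V b} = {a ↔ b}`);
  `Snowballing.spr p λ = Spr(p; λ)`; `Snowballing.sprDist p q = log(log(1 − q)/log(1 − p))`, which IS the printed
  `δ(p, q)` whenever `p ≤ q` (the only regime of Prop. 4.1, `p₁ < p₂`; for `p > q` it is `−δ(p, q)`).
* PROVED `δ`-calculus (each item a printed property of `Spr` / `δ`, §3.1 p. 19): `sprDist_spr`
  (`δ(p, Spr(p; λ)) = λ`), `spr_sprDist` (`Spr(p; δ(p, q)) = q`, "so that `max{p,q} = Spr(min{p,q}; δ(p,q))`"),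
  `sprDist_add` (`δ(p, q) + δ(q, r) = δ(p, r)`, the semigroup law), `spr_lt_one` / `spr_pos` (`Spr` maps into
  `(0, 1)`), `le_spr` / `spr_le_spr` (monotone in `λ`), `sprDist_pos`; plus the two halves of "min over pairs" for
  `tauSet` (`tauSet_le_tau`, `le_tauSet`) and their corollaries. (The customer's own inequalities about `δ` — e.g. the
  room bound `δ(p, q) ≥ (q − p)/((1 − p) log(1/(1 − q)))` — are not printed in the source and live with the customer.)
* The NAMED FACT `EasoHutchcroft2023_snowballing` = Prop. 4.1 in the `Λ = V` form (15) with ALL printed standing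
  hypotheses and the printed quantifier order of the constants (`∃ c₂ c₃` universal, `∀ D`, `∃ c₁ = c₁(D)`,
  `∀ d ≥ 1`, `∃ h₀ = h₀(d, D)`, `∀ G …`): `G` a simple graph (the source allows multigraphs — a special case),
  connected and locally finite (the source's standing convention, p. 3), transitive (`IsGraphTransitive`),
  unimodular (`IsGraphUnimodular`, Lyons–Peres' `|S(x)y| = |S(y)x|` for the full automorphism group, the notion
  the source uses), every vertex of degree `d`; stations `A 1, …, A n` indexed by naturals `1 ≤ i ≤ n` (`n ≥ 1`),
  non-empty, not necessarily finite, with `h ≥ (min_i |A_i|)⁻¹` typed as "`1 ≤ h · |A_i|` for every FINITE station"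
  (an infinite station imposes nothing, as in the source); `0 < p₁ < p₂ < 1`; "at most one infinite cluster
  `P_p`-a.s. for every `p ∈ [p₁, p₂]`" via the tree's `numInfiniteClusters ω ≤ 1`; `p₁ ≥ 1/d`, `δ(p₁, p₂) ≤ D`,
  `0 < h ≤ h₀`.
  SPECIALISATION 1: the auxiliary radius `r` ("`hr ≥ 1`", "`P_p(Piv[1, hr]) < h` on `[p₁, p₂]`") is OMITTED — by
  Remark 4.1 such an `r` always exists under the (kept) uniqueness hypothesis, and `r` enters the conclusion of (14)
  only through `B_{2r}(Λ)`, which is `V` in (15); the constraint `h > 0` that "`hr ≥ 1`" carries is kept explicitly.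
  SPECIALISATION 2: only the `Λ = V` form (15) is typed.
  -- TODO(general form): the finite-domain implication (14) (`τ^Λ`, `B_{2r}(Λ)`, the `Piv` hypothesis on `r`).

Deliberately NOT here: any proof of Prop. 4.1 (ghost fields, Talagrand, the two-ghost inequality — §4 of the
source); any use of it (the customers live under `Summits/…/Transplant/`); nothing about `p_c`, `θ`, or any
particular graph.
-/

noncomputable section

namespace Literature.Probability.Percolation

open _root_.MeasureTheory Literature.Barriers.CriticalPhenomena
open scoped ENNReal

namespace Snowballing

variable {V : Type*}

/-! ## §4.1 vocabulary: the two-point function between sets -/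

/-- `τ_p(x, y) = P_p(x ↔ y)`, the two-point function of Bernoulli-`p` bond percolation on `G`.
[cite: EasoHutchcroft2023, §4.1 p. 25 (τ_p)] -/
def tau (G : SimpleGraph V) (p : unitInterval) (x y : V) : ℝ := (bondPercolation G p).real (openConn x y)

/-- `0 ≤ τ_p(x, y)` (a probability). [cite: EasoHutchcroft2023, §4.1 p. 25 (τ_p = P_p(x ↔ y) is a probability)] -/
theorem tau_nonneg (G : SimpleGraph V) (p : unitInterval) (x y : V) : 0 ≤ tau G p x y := measureReal_nonneg

/-- `τ_p(x, y) ≤ 1` (a probability). [cite: EasoHutchcroft2023, §4.1 p. 25 (τ_p = P_p(x ↔ y) is a probability)] -/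
theorem tau_le_one (G : SimpleGraph V) (p : unitInterval) (x y : V) : tau G p x y ≤ 1 := measureReal_le_one

/-- **`τ_p(A, B) := min_{a ∈ A, b ∈ B} P_p(a ↔ b)`** (Easo–Hutchcroft §4.1, p. 25, with `Λ = V`: "`τ_p(A, B) :=
τ^V_p(A, B)`"; "`τ_p(A) := τ_p(A, A)`" is `tauSet G p A A`). Typed as the INFIMUM over the (possibly infinite) set of
pairs `A ×ˢ B` — the source's sets are "not necessarily finite", so its "min" is an infimum. Junk value: for `A` or `B`
empty the infimum of the empty set of reals is `0` (the source's sets are non-empty).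
[cite: EasoHutchcroft2023, §4.1 p. 25 (definition of τ^Λ_p(A,B), τ_p(A,B), τ_p(A))] -/
def tauSet (G : SimpleGraph V) (p : unitInterval) (A B : Set V) : ℝ :=
  sInf ((fun ab : V × V => tau G p ab.1 ab.2) '' (A ×ˢ B))

/-- `0 ≤ τ_p(A, B)` (an infimum of probabilities). [cite: EasoHutchcroft2023, §4.1 p. 25 (definition of τ_p(A,B))] -/
theorem tauSet_nonneg (G : SimpleGraph V) (p : unitInterval) (A B : Set V) : 0 ≤ tauSet G p A B := by
  refine Real.sInf_nonneg ?_
  rintro _ ⟨ab, -, rfl⟩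
  exact tau_nonneg G p _ _

/-- The defining property of the minimum over pairs, lower half: `τ_p(A, B) ≤ P_p(a ↔ b)` for `a ∈ A`, `b ∈ B`.
[cite: EasoHutchcroft2023, §4.1 p. 25 (definition of τ_p(A,B) as min over a ∈ A, b ∈ B)] -/
theorem tauSet_le_tau (G : SimpleGraph V) (p : unitInterval) {A B : Set V} {a b : V} (ha : a ∈ A) (hb : b ∈ B) :
    tauSet G p A B ≤ tau G p a b := by
  refine csInf_le ⟨0, ?_⟩ ⟨(a, b), ⟨ha, hb⟩, rfl⟩
  rintro _ ⟨ab, -, rfl⟩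
  exact tau_nonneg G p _ _

/-- The defining property of the minimum over pairs, upper half: a common lower bound of all `P_p(a ↔ b)`,
`a ∈ A`, `b ∈ B` (non-empty sets), bounds `τ_p(A, B)` from below.
[cite: EasoHutchcroft2023, §4.1 p. 25 (definition of τ_p(A,B) as min over a ∈ A, b ∈ B)] -/
theorem le_tauSet (G : SimpleGraph V) (p : unitInterval) {A B : Set V} (hA : A.Nonempty) (hB : B.Nonempty) {x : ℝ}
    (h : ∀ a ∈ A, ∀ b ∈ B, x ≤ tau G p a b) : x ≤ tauSet G p A B := by
  obtain ⟨a, ha⟩ := hA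
  obtain ⟨b, hb⟩ := hB
  refine le_csInf ⟨_, ⟨(a, b), ⟨ha, hb⟩, rfl⟩⟩ ?_
  rintro _ ⟨ab, ⟨ha', hb'⟩, rfl⟩
  exact h _ ha' _ hb'

/-- `τ_p(A, B) ≤ 1` for non-empty `A`, `B`. [cite: EasoHutchcroft2023, §4.1 p. 25 (definition of τ_p(A,B); a minimum of probabilities)] -/
theorem tauSet_le_one (G : SimpleGraph V) (p : unitInterval) {A B : Set V} (hA : A.Nonempty) (hB : B.Nonempty) :
    tauSet G p A B ≤ 1 := by
  obtain ⟨a, ha⟩ := hA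
  obtain ⟨b, hb⟩ := hB
  exact (tauSet_le_tau G p ha hb).trans (tau_le_one G p a b)

/-- Shrinking the sets can only increase the minimum: `A' ⊆ A`, `B' ⊆ B`, `A'`, `B'` non-empty ⇒
`τ_p(A, B) ≤ τ_p(A', B')`. [cite: EasoHutchcroft2023, §4.1 p. 25 (definition of τ_p(A,B) as min over a ∈ A, b ∈ B)] -/
theorem tauSet_mono_set (G : SimpleGraph V) (p : unitInterval) {A B A' B' : Set V} (hA : A' ⊆ A) (hB : B' ⊆ B)
    (hA' : A'.Nonempty) (hB' : B'.Nonempty) : tauSet G p A B ≤ tauSet G p A' B' :=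
  le_tauSet G p hA' hB' fun _ ha _ hb => tauSet_le_tau G p (hA ha) (hB hb)

/-! ## §3.1 vocabulary: the sprinkling coordinates -/

/-- **The sprinkling function `Spr(p; λ) = 1 − (1 − p)^{e^λ}`** ("so that `(1 − Spr(p; λ)) = (1 − p)^{e^λ}`").
[cite: EasoHutchcroft2023, §3.1 p. 19 (sprinkling function Spr)] -/
def spr (p lam : ℝ) : ℝ := 1 - (1 - p) ^ Real.exp lam

/-- **The sprinkling distance** `δ(p, q)`: typed as `log( log(1 − q) / log(1 − p) )`, which is the printed
`δ(p, q) = log( log(1 − max{p, q}) / log(1 − min{p, q}) )` for `p ≤ q` (the regime `p₁ < p₂` of Prop. 4.1; for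
`p > q` the typed expression is `−δ(p, q)`). "so that `max{p, q} = Spr(min{p, q}; δ(p, q))`" is `spr_sprDist` below.
[cite: EasoHutchcroft2023, §3.1 p. 19 (definition of δ(p,q))] -/
def sprDist (p q : ℝ) : ℝ := Real.log (Real.log (1 - q) / Real.log (1 - p))

/-- `Spr(p; λ) < 1` for `p < 1`. [cite: EasoHutchcroft2023, §3.1 p. 19 (Spr : (0,1) × ℝ → (0,1))] -/
theorem spr_lt_one {p : ℝ} (lam : ℝ) (hp1 : p < 1) : spr p lam < 1 := by
  unfold spr
  have : 0 < (1 - p) ^ Real.exp lam := Real.rpow_pos_of_pos (by linarith) _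
  linarith

/-- `p = Spr(p; 0) ≤ Spr(p; λ)` for `λ ≥ 0` and `0 ≤ p < 1` (sprinkling increases the parameter).
[cite: EasoHutchcroft2023, §3.1 p. 19 (Spr(p; λ) = 1 − (1 − p)^{e^λ})] -/
theorem le_spr {p lam : ℝ} (hp : 0 ≤ p) (hp1 : p < 1) (hlam : 0 ≤ lam) : p ≤ spr p lam := by
  unfold spr
  have h1p : 0 < 1 - p := by linarith
  have hle : (1 - p) ^ Real.exp lam ≤ (1 - p) ^ (1 : ℝ) :=
    Real.rpow_le_rpow_of_exponent_ge h1p (by linarith) (by simpa using Real.one_le_exp hlam)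
  rw [Real.rpow_one] at hle
  linarith

/-- `0 < Spr(p; λ)` for `0 < p < 1` and `λ ≥ 0`. [cite: EasoHutchcroft2023, §3.1 p. 19 (Spr : (0,1) × ℝ → (0,1))] -/
theorem spr_pos {p lam : ℝ} (hp : 0 < p) (hp1 : p < 1) (hlam : 0 ≤ lam) : 0 < spr p lam :=
  hp.trans_le (le_spr hp.le hp1 hlam)

/-- `Spr(p; ·)` is monotone in `λ` (for `0 ≤ p < 1`). [cite: EasoHutchcroft2023, §3.1 p. 19 (Spr(p; λ) = 1 − (1 − p)^{e^λ})] -/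
theorem spr_le_spr {p lam mu : ℝ} (hp : 0 ≤ p) (hp1 : p < 1) (h : lam ≤ mu) : spr p lam ≤ spr p mu := by
  unfold spr
  have h1p : 0 < 1 - p := by linarith
  have hle : (1 - p) ^ Real.exp mu ≤ (1 - p) ^ Real.exp lam :=
    Real.rpow_le_rpow_of_exponent_ge h1p (by linarith) (Real.exp_le_exp.2 h)
  linarith

/-- `δ` is the coordinate of `Spr`: `δ(p, Spr(p; λ)) = λ` for `0 < p < 1`.
[cite: EasoHutchcroft2023, §3.1 p. 19 (max{p,q} = Spr(min{p,q}; δ(p,q)))] -/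
theorem sprDist_spr {p : ℝ} (lam : ℝ) (hp : 0 < p) (hp1 : p < 1) : sprDist p (spr p lam) = lam := by
  have h1p : 0 < 1 - p := by linarith
  have hlog : Real.log (1 - p) ≠ 0 := (Real.log_neg h1p (by linarith)).ne
  unfold sprDist spr
  rw [sub_sub_cancel, Real.log_rpow h1p, mul_div_assoc, div_self hlog, mul_one, Real.log_exp]

/-- "so that `max{p, q} = Spr(min{p, q}; δ(p, q))`": `Spr(p; δ(p, q)) = q` for `0 < p < 1`, `q < 1`, `p ≤ q`.
[cite: EasoHutchcroft2023, §3.1 p. 19 (max{p,q} = Spr(min{p,q}; δ(p,q)))] -/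
theorem spr_sprDist {p q : ℝ} (hp : 0 < p) (hp1 : p < 1) (hq1 : q < 1) (hpq : p ≤ q) : spr p (sprDist p q) = q := by
  have h1p : 0 < 1 - p := by linarith
  have h1q : 0 < 1 - q := by linarith
  have hLp : Real.log (1 - p) < 0 := Real.log_neg h1p (by linarith)
  have hLq : Real.log (1 - q) < 0 := Real.log_neg h1q (by linarith)
  have hratio : 0 < Real.log (1 - q) / Real.log (1 - p) := div_pos_of_neg_of_neg hLq hLp
  unfold spr sprDist
  rw [Real.exp_log hratio]
  have : (1 - p) ^ (Real.log (1 - q) / Real.log (1 - p)) = 1 - q := by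
    rw [Real.rpow_def_of_pos h1p, mul_div_cancel₀ _ hLp.ne, Real.exp_log h1q]
  rw [this]
  ring

/-- `δ` is additive along increasing parameters: `δ(p, q) + δ(q, r) = δ(p, r)` (the semigroup property
"`Spr(p; λ + μ) = Spr(Spr(p; λ); μ)`"), for `p, q, r ∈ (0, 1)`.
[cite: EasoHutchcroft2023, §3.1 p. 19 (semigroup property of Spr)] -/
theorem sprDist_add {p q r : ℝ} (hp : 0 < p) (hp1 : p < 1) (hq : 0 < q) (hq1 : q < 1) (hr : 0 < r)
    (hr1 : r < 1) : sprDist p q + sprDist q r = sprDist p r := by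
  have hLp : Real.log (1 - p) < 0 := Real.log_neg (by linarith) (by linarith)
  have hLq : Real.log (1 - q) < 0 := Real.log_neg (by linarith) (by linarith)
  have hLr : Real.log (1 - r) < 0 := Real.log_neg (by linarith) (by linarith)
  unfold sprDist
  rw [← Real.log_mul (div_pos_of_neg_of_neg hLq hLp).ne' (div_pos_of_neg_of_neg hLr hLq).ne']
  congr 1
  rw [div_mul_div_comm, mul_comm (Real.log (1 - q)) (Real.log (1 - r)), mul_div_mul_right _ _ hLq.ne]

/-- `δ(p, q) > 0` for `0 < p < q < 1` (`log(1 − q) < log(1 − p) < 0`). [cite: EasoHutchcroft2023, §3.1 p. 19 (definition of δ(p,q))] -/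
theorem sprDist_pos {p q : ℝ} (hp : 0 < p) (hpq : p < q) (hq1 : q < 1) : 0 < sprDist p q := by
  have h1p : 0 < 1 - p := by linarith
  have h1q : 0 < 1 - q := by linarith
  have hLp : Real.log (1 - p) < 0 := Real.log_neg h1p (by linarith)
  have hLq : Real.log (1 - q) < 0 := Real.log_neg h1q (by linarith)
  have hlt : Real.log (1 - q) < Real.log (1 - p) := Real.log_lt_log h1q (by linarith)
  unfold sprDist
  refine Real.log_pos ?_
  rw [one_lt_div_of_neg hLp]
  exact hlt

end Snowballing

/-! ## The named fact: Proposition 4.1 in the `Λ = V` form (15) -/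

/-- NAMED FACT — **Easo–Hutchcroft 2023, Proposition 4.1 (Snowballing), the `Λ = V` form (15)**: "For each `d ≥ 1`
and `D < ∞` there exist positive constants `c₁ = c₁(D)` and `h₀ = h₀(d, D)`, and universal positive constants `c₂`
and `c₃` such that the following holds. Let `G = (V, E)` be a unimodular transitive graph with vertex degree `d`, let
`A₁, …, A_n` be non-empty sets of vertices in `G`, and suppose that `0 < p₁ < p₂ < 1` are such that there is at most
one infinite cluster `P_p`-almost surely for every `p ∈ [p₁, p₂]`. Let `h ≥ (min_i |A_i|)⁻¹` and let `r` be a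
positive integer with `hr ≥ 1` such that `P_p(Piv[1, hr]) < h` for every `p ∈ [p₁, p₂]`. If `p₁ ≥ 1/d`,
`δ = δ(p₁, p₂) ≤ D`, and `h ≤ h₀` then … taking `Λ = V` yields the implication
`( h^{c₁δ³} ≤ c₃ n⁻¹ and τ_{p₁}(A_i ∪ A_{i+1}) ≥ 4 h^{c₁δ⁴} for every i = 1, …, n − 1 ) ⇒
( τ_{p₂}(A₁, A_n) ≥ c₂ τ_{p₁}(A₁) τ_{p₁}(A_n) )` (15)."
TYPING: constants in the printed order (`c₂, c₃` universal; `c₁ = c₁(D)`; `h₀ = h₀(d, D)`); `G` a connected, locally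
finite (standing convention p. 3), transitive (`IsGraphTransitive`), unimodular (`IsGraphUnimodular`) simple graph
with all degrees `d`; stations `A 1, …, A n` (`n ≥ 1`, indices outside `[1, n]` unused), non-empty, possibly
infinite; `h ≥ (min_i |A_i|)⁻¹` as `1 ≤ h · |A i|` for every finite station; uniqueness on `[p₁, p₂]` via
`numInfiniteClusters ω ≤ 1` a.s.; `τ_p(A, B)` = `Snowballing.tauSet` (infimum over pairs, p. 25), `δ` =
`Snowballing.sprDist` (p. 19). SPECIALISATIONS: (1) the radius `r` (`hr ≥ 1`, `P_p(Piv[1, hr]) < h`) is omitted —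
"The fact that we can always find an integer `r` such that `P_p(Piv[1, hr]) < h` for every `p ∈ [p₁, p₂]` can be
deduced from the fact that there is at most one infinite cluster … by an easy compactness argument" (Remark 4.1),
and `r` enters (14) only through `B_{2r}(Λ)`, which is `V` here; its trace `h > 0` is kept; (2) only `Λ = V`.
-- TODO(general form): the finite-domain form (14) with `τ^Λ_p`, `B_{2r}(Λ)` and the `Piv[1, hr]` hypothesis.
Users take `(h : EasoHutchcroft2023_snowballing)`.
[cite: EasoHutchcroft2023, Prop. 4.1 (15), pp. 25–26; Remark 4.1 p. 26; §3.1 p. 19 (δ); §4.1 p. 25 (τ)] -/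
def EasoHutchcroft2023_snowballing : Prop :=
  ∃ c₂ c₃ : ℝ, 0 < c₂ ∧ 0 < c₃ ∧ ∀ D : ℝ, ∃ c₁ : ℝ, 0 < c₁ ∧ ∀ d : ℕ, 1 ≤ d → ∃ h₀ : ℝ, 0 < h₀ ∧
    ∀ {W : Type} (G : SimpleGraph W) [G.LocallyFinite],
      G.Connected → IsGraphTransitive G → IsGraphUnimodular G → (∀ v : W, G.degree v = d) →
      ∀ (n : ℕ) (A : ℕ → Set W) (p₁ p₂ : unitInterval) (h : ℝ),
        1 ≤ n → (∀ i, 1 ≤ i → i ≤ n → (A i).Nonempty) →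
        0 < (p₁ : ℝ) → (p₁ : ℝ) < p₂ → (p₂ : ℝ) < 1 →
        (∀ p : unitInterval, (p₁ : ℝ) ≤ p → (p : ℝ) ≤ p₂ →
            ∀ᵐ ω ∂(bondPercolation G p), numInfiniteClusters ω ≤ 1) →
        (∀ i, 1 ≤ i → i ≤ n → (A i).Finite → 1 ≤ h * ((A i).ncard : ℝ)) →
        (1 : ℝ) / d ≤ p₁ → Snowballing.sprDist p₁ p₂ ≤ D → 0 < h → h ≤ h₀ →
        h ^ (c₁ * Snowballing.sprDist p₁ p₂ ^ 3) ≤ c₃ / n →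
        (∀ i, 1 ≤ i → i + 1 ≤ n → 4 * h ^ (c₁ * Snowballing.sprDist p₁ p₂ ^ 4) ≤
            Snowballing.tauSet G p₁ (A i ∪ A (i + 1)) (A i ∪ A (i + 1))) →
        c₂ * Snowballing.tauSet G p₁ (A 1) (A 1) * Snowballing.tauSet G p₁ (A n) (A n) ≤
          Snowballing.tauSet G p₂ (A 1) (A n)

end Literature.Probability.Percolation
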